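import Summits.ResolutionOfSingularities.ResolutionOfSingularities.Theorems.EquisingularLiftEquisingularLiftProjectiveAmbientFibre
import Literature.AlgebraicGeometry.Resolution.AffineBlowupIntegral
import HarnessLib

/-!
# `EquisingularLift`, line `Sketch` v8/v9 — the scheme-theoretic special fibre of `ℙⁿ_O` is integral

Crux `stmt-ResolutionOfSingularities-15660` = `Theses.EquisingularLift.EquisingularLift`; helper for the consumers of
the structural stub `stub_chain_of_horizChain` (p463069) and of the research stub `stub_horizResolution_three`,
which carry the hypothesis `IsIntegral (P ×_{Spec O} Spec κ)` for the `O`-ambient `P`; this file discharges it for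
`P = ℙⁿ_O = Proj O[x₀, …, xₙ]` over any local ring `O` (lead res-L1-w45b-lead-1, 2026-08-26T18:58:59Z, request (c)).
[OURS · L1 W4.5b] NOT a statement of any manuscript.

Proof: `ℙⁿ_κ = ℙⁿ_O ×_{Spec O} Spec κ` (`ProjectiveAmbientFibre.isPullback_projMap`, Liu Prop. 3.1.9 / Ex. 3.1.10,
for the surjection `O → κ`), and `ℙⁿ_κ = Proj κ[x₀, …, xₙ]` is integral (`Proj` of a graded domain with non-zero
irrelevant ideal, `Proj.isIntegral`).

References: Q. Liu, *Algebraic Geometry and Arithmetic Curves* (2002), Prop. 2.4.2, Prop. 3.1.9, Ex. 3.1.10.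
-/

set_option linter.dupNamespace false -- mandated namespace of this single-conjunct summit

noncomputable section

open CategoryTheory CategoryTheory.Limits AlgebraicGeometry TopologicalSpace
open MvPolynomial Literature.AlgebraicGeometry.Resolution

attribute [local instance] MvPolynomial.gradedAlgebra

namespace Summit.ResolutionOfSingularities.ResolutionOfSingularities.Cruxes.EquisingularLift.StrataSplit

/-- The irrelevant ideal of `K[x₀, …, xₙ]` is non-zero (it contains `x₀`). [folklore] -/
theorem irrelevant_homogeneousSubmodule_ne_bot (n : ℕ) (K : Type) [CommRing K] [Nontrivial K] :
    HomogeneousIdeal.irrelevant (homogeneousSubmodule (Fin (n + 1)) K) ≠ ⊥ := by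
  intro h
  have hx : (X 0 : MvPolynomial (Fin (n + 1)) K) ∈
      (HomogeneousIdeal.irrelevant (homogeneousSubmodule (Fin (n + 1)) K)).toIdeal :=
    HomogeneousIdeal.mem_irrelevant_of_mem _ zero_lt_one (isHomogeneous_X K 0)
  rw [h] at hx
  exact MvPolynomial.X_ne_zero 0 ((Submodule.mem_bot _).1 hx)

/-- **`ℙⁿ_K` is an integral scheme** for a field `K` (`Proj` of the graded domain `K[x₀, …, xₙ]`). [folklore] -/
theorem isIntegral_proj_homogeneousSubmodule (n : ℕ) (K : Type) [Field K] :
    IsIntegral (Proj (homogeneousSubmodule (Fin (n + 1)) K)) :=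
  Proj.isIntegral _ (irrelevant_homogeneousSubmodule_ne_bot n K)

/-- **The scheme-theoretic special fibre of `ℙⁿ_O → Spec O` is integral.** For a local ring `O` with residue field
`κ`, the fibre product `ℙⁿ_O ×_{Spec O} Spec κ` (Mathlib's chosen pullback of the structure morphism
`Proj O[x₀,…,xₙ] → Spec O[x]₀ → Spec O` along `Spec κ → Spec O`) is an integral scheme: it is `ℙⁿ_κ`.
[OURS · L1 W4.5b] helper for the crux `EquisingularLift` (hypothesis `IsIntegral (P ×_O κ)` of
`stub_chain_of_horizChain` / `stub_horizResolution_three` for `P = ℙⁿ_O`);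
[cite: Liu2002, Prop. 3.1.9 and Ex. 3.1.10] -/
theorem isIntegral_pullback_projectiveSpace_residue : ∀ (O : Type) [CommRing O] [IsLocalRing O] (n : ℕ),
    AlgebraicGeometry.IsIntegral (CategoryTheory.Limits.pullback
      (Proj.toSpecZero (MvPolynomial.homogeneousSubmodule (Fin (n + 1)) O) ≫
        Spec.map (CommRingCat.ofHom (algebraMap O ((MvPolynomial.homogeneousSubmodule (Fin (n + 1)) O) 0))))
      (Spec.map (CommRingCat.ofHom (IsLocalRing.residue O)))) := by
  intro O _ _ n
  let π : O →+* IsLocalRing.ResidueField O := IsLocalRing.residue O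
  have hπ : Function.Surjective π := IsLocalRing.residue_surjective
  let φ : homogeneousSubmodule (Fin (n + 1)) O →+*ᵍ homogeneousSubmodule (Fin (n + 1)) (IsLocalRing.ResidueField O) :=
    ⟨MvPolynomial.map π, fun h ↦ h.map π⟩
  have hφ : ∀ p, φ p = MvPolynomial.map π p := fun _ ↦ rfl
  have hφ' := ProjectiveAmbientFibre.irrelevant_le_map_gradedMap π φ hφ
  have hP := ProjectiveAmbientFibre.isPullback_projMap π φ hφ hπ hφ'
  haveI := isIntegral_proj_homogeneousSubmodule n (IsLocalRing.ResidueField O)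
  exact IsIntegral.of_isIso hP.isoPullback.hom

end Summit.ResolutionOfSingularities.ResolutionOfSingularities.Cruxes.EquisingularLift.StrataSplit

end
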